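import Summits.QuantumFields.YangMills.Theorems.UnitScaleTiltHalvingP1FlatCoreFrameLinTowerSum
import Mathlib.Analysis.Complex.Liouville
import Mathlib.Analysis.Calculus.MeanValue
import HarnessLib

/-!
# The effective-gauge tower in log coordinates: the `k`-UNIFORM Lipschitz row by the Cauchy route (J-N05♭ `core′`, induction brick F3)

Sub-problem `YangMills` of summit `QuantumFields`; route `UnitScaleTilt`, line H = `BirthV10.stub_halvingStep`, pillar P1♭ `core′`
(LEAD-H T2♭-PLAN v1.1; rulings L-3/L-4/L-5; LEAD-H 11:30:32Z/11:36:33Z).  Helper file (`--supports stmt-QuantumFields-19200 --as helper`);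
it closes no item.  HONEST LABEL: YM₃ on `T³` is rung R3 of the ladder, NOT the Clay problem; nothing here is a mass-gap statement.

## What this file adds

Print (p. 97): «Using the analyticity properties of `C′(λ)` … (1.124) … we get the estimate (1.125)» — the Lipschitz row of the family
contraction (✓`B8SectEKLevelFamily`, hypothesis `hC125`) is a CAUCHY ESTIMATE on the value bound (1.121).  Here, for the nonlinear part
`C(μ) := log κ_k[μ](y) − (Q′_k μ)(y)` of the effective-gauge tower of the double-bar tower of a general level-`0` field `W`
(`κ[μ]_0 = exp ∘ μ`; the tower is a hypothesis-function `κf` obeying the recursion of ✓`exists_effGauge` for every bottom gauge):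
* §1 the one-variable Cauchy–Lipschitz lemma `norm_sub_le_of_bound_on_ball` (value bound `M` on `B(0,R)` ⇒ Lipschitz constant `2M/R` on `B(0,R/2)`);
* §2 `siteAvgIter_add_smul` (the linear part along a complex line) and §3 `analyticAt_effGauge_line` — the tower along `μ + τν` is
  analytic in `τ` (values and inverses, level by level: `κ_{i+1}(y) = κ_i(ȳ)·e^{−mean_idx log(hol·s)}·v(X_i)(y)`, ✓`effGauge_step_eq_eml`,
  ✓`analyticAt_mlog`, Mathlib `exp_analytic`), under the disc condition `‖hol·s − 1‖ < 1` discharged by §4 from the size row;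
* §5 ★★★ `norm_Cnl_sub_Cnl_le` — `‖C(μ + ν) − C(μ)‖ ≤ 2·M·n/r`, `M = 640(a + r + δ + 5(ω + r))(ω + r)` the value bound of
  ✓`P1FlatCoreFrameLinTowerSum.norm_mlog_effGauge_top_sub_siteAvgIter_le` on the complex ball of radius `r/n` (`‖ν‖ ≤ n`, linear
  oscillations of `ν` `≤ n·2^{j+1}/2^k`, `n ≤ r/4`) — the (1.125) row in torus letters, constant independent of `k`.

[cite: Balaban1985RegularSpaces, Sect. E (1.122)-(1.125) pp.96-97; Balaban1985Averaging, (97)-(100) p.32, (110) p.34]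
-/

noncomputable section

open NormedSpace Metric
open Literature.MathematicalPhysics.QuantumFieldTheory.Balaban1983to89
open T4Continuum BlockAveraging ExpMeanLog MatrixLog
open B10Eq27TorusAxialLog (holT gaugeActT)
open B7TransferAnalyticMean (meanCLM meanCLM_apply norm_meanCLM_apply_le)
open B12Membership313II (bchLog exp_bchLog norm_expMul_sub_one_lt_one)
open BlockAveragingEMLAnalyticMean (eml_eq_exp_meanCLM)
open B7Prop1Explicit (units_val_inv_eq_exp_neg)
open LatticeFieldCalculus (siteAvg siteAvgIter)
open Summit.QuantumFields.YangMills.Theorems.Prop8ChartDoubleBar (vframeU dbarIterU)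
open Summit.QuantumFields.YangMills.Theorems.P1FlatCoreFrameLinBCH (norm_meanCLM_le_of_forall_le)
open Summit.QuantumFields.YangMills.Theorems.P1FlatCoreFrameLinTower (effGauge_step_eq_eml)
open Summit.QuantumFields.YangMills.Theorems.P1FlatCoreFrameLinOsc (norm_bchLog_le_two_mul)
open Summit.QuantumFields.YangMills.Theorems.P1FlatCoreFrameLinTowerSum (norm_siteAvgIter_le
  exp_mlog_and_norm_mlog_effGauge_sub_siteAvgIter_le)

namespace Summit.QuantumFields.YangMills.Theorems.P1FlatCoreFrameLinLipschitz

/-! ## §1 The one-variable Cauchy–Lipschitz lemma -/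

section Cauchy

variable {F : Type*} [NormedAddCommGroup F] [NormedSpace ℂ F]

/-- **CAUCHY ⇒ LIPSCHITZ**: a function differentiable on `B(0,R)` and bounded by `M` there is `2M/R`-Lipschitz on `B(0,R/2)` (Cauchy's
estimate `‖g′(x)‖ ≤ M/(R/2)` on the spheres of radius `R/2` around the points of the half ball, then the mean-value inequality on the convex
half ball).  Print's (1.124)–(1.125) use exactly this with `R = α₄/max{|λ₀|, |Dλ₀|}`. [folklore; cite: Balaban1985RegularSpaces, (1.124)-(1.125) p.97] -/
theorem norm_sub_le_of_bound_on_ball {g : ℂ → F} {R M : ℝ} (hR : 0 < R) (hd : DifferentiableOn ℂ g (ball (0 : ℂ) R))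
    (hM : ∀ τ ∈ ball (0 : ℂ) R, ‖g τ‖ ≤ M) {y₁ y₂ : ℂ} (h1 : y₁ ∈ ball (0 : ℂ) (R / 2)) (h2 : y₂ ∈ ball (0 : ℂ) (R / 2)) :
    ‖g y₁ - g y₂‖ ≤ 2 * M / R * ‖y₁ - y₂‖ := by
  have hsub : ∀ x ∈ ball (0 : ℂ) (R / 2), closedBall x (R / 2) ⊆ ball (0 : ℂ) R := by
    intro x hx τ hτ
    rw [mem_ball, dist_zero_right] at hx ⊢
    rw [mem_closedBall, dist_eq_norm] at hτ
    calc ‖τ‖ = ‖(τ - x) + x‖ := by rw [sub_add_cancel]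
      _ ≤ ‖τ - x‖ + ‖x‖ := norm_add_le _ _
      _ < R := by linarith
  have hderiv : ∀ x ∈ ball (0 : ℂ) (R / 2), ‖deriv g x‖ ≤ M / (R / 2) := by
    intro x hx
    have hdc : DiffContOnCl ℂ g (ball x (R / 2)) :=
      (hd.mono (closure_ball_subset_closedBall.trans (hsub x hx))).diffContOnCl
    exact Complex.norm_deriv_le_of_forall_mem_sphere_norm_le (by positivity) hdc
      fun τ hτ => hM τ (hsub x hx (sphere_subset_closedBall hτ))
  have hdiffAt : ∀ x ∈ ball (0 : ℂ) (R / 2), DifferentiableAt ℂ g x := fun x hx =>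
    hd.differentiableAt (isOpen_ball.mem_nhds (ball_subset_ball (by linarith) hx))
  have h := (convex_ball (0 : ℂ) (R / 2)).norm_image_sub_le_of_norm_deriv_le hdiffAt hderiv h2 h1
  calc ‖g y₁ - g y₂‖ ≤ M / (R / 2) * ‖y₁ - y₂‖ := h
    _ = 2 * M / R * ‖y₁ - y₂‖ := by congr 1; field_simp

end Cauchy

variable {𝔸 : Type*} [NormedRing 𝔸] [NormedAlgebra ℂ 𝔸] [CompleteSpace 𝔸]
variable {P : Params}

/-! ## §2 The linear part along a complex line -/

section Linear

omit [CompleteSpace 𝔸] in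
/-- `Q′_j (μ + τν) = Q′_j μ + τ·Q′_j ν` (the iterated site-average is `ℂ`-linear). [cite: Balaban1984PropagatorsI, (1.20) p.20] -/
theorem siteAvgIter_add_smul (μ ν : Site P 0 → 𝔸) (τ : ℂ) :
    ∀ j : ℕ, siteAvgIter j (μ + τ • ν) = siteAvgIter j μ + τ • siteAvgIter j ν
  | 0 => rfl
  | j + 1 => by
    show siteAvg (siteAvgIter j (μ + τ • ν)) = siteAvg (siteAvgIter j μ) + τ • siteAvg (siteAvgIter j ν)
    rw [siteAvgIter_add_smul μ ν τ j]
    funext y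
    simp only [LatticeFieldCalculus.siteAvg, Pi.add_apply, Pi.smul_apply, Finset.sum_add_distrib, smul_add, ← Finset.smul_sum]
    rw [smul_comm]

end Linear

/-! ## §3 Analyticity of the tower along a complex line -/

section Analytic

/-- The unit of a nonlinear mean is the exponential of the mean of the logarithms (value). [cite: Balaban1987RG1, (0.4) p.253] -/
theorem val_unit_eml {ι : Type*} [Fintype ι] (f : ι → 𝔸) :
    (((isUnit_eml f).unit : 𝔸ˣ) : 𝔸) = exp (meanCLM ι 𝔸 fun i => mlog (f i)) := by
  rw [IsUnit.unit_spec, eml_eq_exp_meanCLM]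

/-- The unit of a nonlinear mean is the exponential of the mean of the logarithms (inverse). [cite: Balaban1987RG1, (0.4) p.253] -/
theorem val_inv_unit_eml {ι : Type*} [Fintype ι] (f : ι → 𝔸) :
    ((((isUnit_eml f).unit)⁻¹ : 𝔸ˣ) : 𝔸) = exp (-(meanCLM ι 𝔸 fun i => mlog (f i))) :=
  units_val_inv_eq_exp_neg (val_unit_eml f)

omit [CompleteSpace 𝔸] in
/-- A mean of `τ`-analytic families is `τ`-analytic. [folklore] -/
theorem analyticAt_meanCLM_family {ι : Type*} [Fintype ι] {φ : ℂ → ι → 𝔸} {τ₀ : ℂ} (h : ∀ i, AnalyticAt ℂ (fun τ => φ τ i) τ₀) :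
    AnalyticAt ℂ (fun τ => meanCLM ι 𝔸 (φ τ)) τ₀ := by
  simp only [meanCLM_apply]
  exact (Finset.analyticAt_fun_sum _ fun i _ => h i).fun_const_smul

/-- **★ THE EFFECTIVE-GAUGE TOWER ALONG A COMPLEX LINE IS ANALYTIC** (print p. 96: «We may admit configurations `λ, X` with values in the
complexified algebra … all the above equations and inequalities are valid also»; p. 97 «the analyticity properties of `C′(λ)`»): for a
tower-valued function `κf` of the bottom gauge obeying the recursion of ✓`exists_effGauge` with `κf m 0 = exp ∘ m`, and a complex line
`τ ↦ μ + τν`, if at `τ₀` every stair-times-relative-factor `X_i(Γ_{ȳ,x})·κ_i(x)⁻¹κ_i(ȳ)` (`i < k`) lies in the disc of the logarithm series,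
then `τ ↦ κf(μ + τν)_i(x)` and its inverse are analytic at `τ₀` for all `i ≤ k` (level by level through ✓`effGauge_step_eq_eml`:
`κ_{i+1}(y) = κ_i(ȳ)·exp(−mean_idx log(hol·s))·v(X_i)(y)`). [cite: Balaban1985RegularSpaces, Sect. E pp.96-97; Balaban1985Averaging, (97)-(100) p.32] -/
theorem analyticAt_effGauge_line (W : GaugeField P 0 𝔸ˣ) (κf : (Site P 0 → 𝔸) → (i : ℕ) → GaugeTransf P i 𝔸ˣ)
    (hs : ∀ (m : Site P 0 → 𝔸) (i : ℕ) (y : Site P (i + 1)),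
      κf m (i + 1) y = (vframeU (gaugeActT (κf m i) (dbarIterU i W)) y)⁻¹ * κf m i (emb y) * vframeU (dbarIterU i W) y)
    (h0 : ∀ (m : Site P 0 → 𝔸) (x : Site P 0), ((κf m 0 x : 𝔸ˣ) : 𝔸) = exp (m x))
    (μ ν : Site P 0 → 𝔸) (τ₀ : ℂ) (k : ℕ)
    (hdisc : ∀ i < k, ∀ (y : Site P (i + 1)) (idx : Idx P),
      ‖((holT (dbarIterU i W) (emb y) (stairWord idx.2.1 (off idx.1)) : 𝔸ˣ) : 𝔸) *
          (((κf (μ + τ₀ • ν) i (walkEnd (emb y) (stairWord idx.2.1 (off idx.1))))⁻¹ * κf (μ + τ₀ • ν) i (emb y) : 𝔸ˣ) : 𝔸) - 1‖ < 1) :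
    ∀ i ≤ k, ∀ x : Site P i, AnalyticAt ℂ (fun τ : ℂ => ((κf (μ + τ • ν) i x : 𝔸ˣ) : 𝔸)) τ₀ ∧
      AnalyticAt ℂ (fun τ : ℂ => (((κf (μ + τ • ν) i x)⁻¹ : 𝔸ˣ) : 𝔸)) τ₀ := by
  intro i
  induction i with
  | zero =>
    intro _ x
    have hlin : AnalyticAt ℂ (fun τ : ℂ => μ x + τ • ν x) τ₀ := analyticAt_const.add (analyticAt_id.smul analyticAt_const)
    have hval : (fun τ : ℂ => ((κf (μ + τ • ν) 0 x : 𝔸ˣ) : 𝔸)) = fun τ => exp (μ x + τ • ν x) := by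
      funext τ; rw [h0]; rfl
    have hinv : (fun τ : ℂ => (((κf (μ + τ • ν) 0 x)⁻¹ : 𝔸ˣ) : 𝔸)) = fun τ => exp (-(μ x + τ • ν x)) := by
      funext τ; exact units_val_inv_eq_exp_neg (by rw [h0]; rfl)
    rw [hval, hinv]
    exact ⟨(exp_analytic _).fun_comp_of_eq hlin rfl, (exp_analytic _).fun_comp_of_eq hlin.neg rfl⟩
  | succ i ih =>
    intro hik y
    have hi : i < k := Nat.lt_of_succ_le hik
    have ihi := ih hi.le
    -- the family `hol·s` along the line and the mean of its logarithms
    have hfam : ∀ idx : Idx P, AnalyticAt ℂ (fun τ : ℂ =>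
        ((holT (dbarIterU i W) (emb y) (stairWord idx.2.1 (off idx.1)) : 𝔸ˣ) : 𝔸) *
          (((κf (μ + τ • ν) i (walkEnd (emb y) (stairWord idx.2.1 (off idx.1))))⁻¹ * κf (μ + τ • ν) i (emb y) : 𝔸ˣ) : 𝔸)) τ₀ := by
      intro idx
      simp only [Units.val_mul]
      exact analyticAt_const.fun_mul ((ihi _).2.fun_mul (ihi _).1)
    have hM : AnalyticAt ℂ (fun τ : ℂ => meanCLM (Idx P) 𝔸 fun idx : Idx P =>
        mlog (((holT (dbarIterU i W) (emb y) (stairWord idx.2.1 (off idx.1)) : 𝔸ˣ) : 𝔸) *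
          (((κf (μ + τ • ν) i (walkEnd (emb y) (stairWord idx.2.1 (off idx.1))))⁻¹ * κf (μ + τ • ν) i (emb y) : 𝔸ˣ) : 𝔸))) τ₀ :=
      analyticAt_meanCLM_family fun idx => (MatrixLog.analyticAt_mlog (hdisc i hi y idx)).fun_comp_of_eq (hfam idx) rfl
    -- the step as a product of three analytic factors
    have hval : (fun τ : ℂ => ((κf (μ + τ • ν) (i + 1) y : 𝔸ˣ) : 𝔸)) = fun τ =>
        ((κf (μ + τ • ν) i (emb y) : 𝔸ˣ) : 𝔸) *
          exp (-(meanCLM (Idx P) 𝔸 fun idx : Idx P =>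
            mlog (((holT (dbarIterU i W) (emb y) (stairWord idx.2.1 (off idx.1)) : 𝔸ˣ) : 𝔸) *
              (((κf (μ + τ • ν) i (walkEnd (emb y) (stairWord idx.2.1 (off idx.1))))⁻¹ * κf (μ + τ • ν) i (emb y) : 𝔸ˣ) : 𝔸)))) *
          ((vframeU (dbarIterU i W) y : 𝔸ˣ) : 𝔸) := by
      funext τ
      rw [effGauge_step_eq_eml W (κf (μ + τ • ν)) (hs (μ + τ • ν)) i y, Units.val_mul, Units.val_mul, val_inv_unit_eml]
    have hinv : (fun τ : ℂ => (((κf (μ + τ • ν) (i + 1) y)⁻¹ : 𝔸ˣ) : 𝔸)) = fun τ =>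
        (((vframeU (dbarIterU i W) y)⁻¹ : 𝔸ˣ) : 𝔸) *
          exp (meanCLM (Idx P) 𝔸 fun idx : Idx P =>
            mlog (((holT (dbarIterU i W) (emb y) (stairWord idx.2.1 (off idx.1)) : 𝔸ˣ) : 𝔸) *
              (((κf (μ + τ • ν) i (walkEnd (emb y) (stairWord idx.2.1 (off idx.1))))⁻¹ * κf (μ + τ • ν) i (emb y) : 𝔸ˣ) : 𝔸))) *
          (((κf (μ + τ • ν) i (emb y))⁻¹ : 𝔸ˣ) : 𝔸) := by
      funext τ
      rw [effGauge_step_eq_eml W (κf (μ + τ • ν)) (hs (μ + τ • ν)) i y, mul_inv_rev, mul_inv_rev, inv_inv, Units.val_mul,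
        Units.val_mul, val_unit_eml, mul_assoc]
    rw [hval, hinv]
    exact ⟨((ihi _).1.fun_mul ((exp_analytic _).fun_comp_of_eq hM.neg rfl)).fun_mul analyticAt_const,
      (analyticAt_const.fun_mul ((exp_analytic _).fun_comp_of_eq hM rfl)).fun_mul (ihi _).2⟩

/-- **THE DISC CONDITION FROM THE SIZE ROW**: if `κ = exp ∘ l` with `‖l‖ ≤ a″` at `x` and `ȳ`, the stair `hol` is within `δ` of `1`,
`δ ≤ 1/2` and `2δ + 4a″ ≤ 1/4`, then `‖hol·κ(x)⁻¹κ(ȳ) − 1‖ < 1` (`hol = e^{log hol}`, `κ(x)⁻¹κ(ȳ) = e^{bchLog(−l x, l ȳ)}`,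
✓`norm_expMul_sub_one_lt_one`). [cite: Balaban1985Averaging, (21) p.21, (110) p.34] -/
theorem norm_stairRel_sub_one_lt_one {j : ℕ} (hol : 𝔸ˣ) (κ : GaugeTransf P j 𝔸ˣ) (l : Site P j → 𝔸) (x z : Site P j)
    (hκ : ∀ x, ((κ x : 𝔸ˣ) : 𝔸) = exp (l x)) {δ a'' : ℝ} (hH : ‖(hol : 𝔸) - 1‖ ≤ δ) (hx : ‖l x‖ ≤ a'') (hz : ‖l z‖ ≤ a'')
    (hδ : δ ≤ 1 / 2) (hr : 2 * δ + 4 * a'' ≤ 1 / 4) :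
    ‖(hol : 𝔸) * ((((κ x)⁻¹ * κ z) : 𝔸ˣ) : 𝔸) - 1‖ < 1 := by
  have ha : 0 ≤ a'' := (norm_nonneg _).trans hx
  have hδ0 : 0 ≤ δ := (norm_nonneg _).trans hH
  have h1 : ‖(hol : 𝔸) - 1‖ < 1 := hH.trans_lt (by linarith)
  have hHn : ‖mlog (hol : 𝔸)‖ ≤ 2 * δ := (norm_mlog_le_two_mul (hH.trans hδ)).trans (by linarith)
  have hrel : ((((κ x)⁻¹ * κ z) : 𝔸ˣ) : 𝔸) = exp (-(l x)) * exp (l z) := by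
    rw [Units.val_mul, units_val_inv_eq_exp_neg (hκ x), hκ z]
  have h2 : ‖-(l x)‖ + ‖l z‖ ≤ 1 / 4 := by rw [norm_neg]; linarith
  have hSn : ‖bchLog (-(l x)) (l z)‖ ≤ 2 * (a'' + a'') := norm_bchLog_le_two_mul (by rwa [norm_neg]) hz (by linarith)
  rw [hrel, ← exp_bchLog (norm_expMul_sub_one_lt_one h2)]
  conv_lhs => rw [← exp_mlog h1]
  exact norm_expMul_sub_one_lt_one (by linarith)

end Analytic

/-! ## §4 The Lipschitz row (1.125) in torus letters -/

section Lipschitz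

/-- **★★★ THE `k`-UNIFORM LIPSCHITZ ROW (1.125) OF THE EFFECTIVE-GAUGE TOWER, BY CAUCHY**: let `κf` be a tower-valued function of the
bottom gauge obeying the recursion of ✓`exists_effGauge` for the double-bar tower of `W` with `κf m 0 = exp ∘ m`; stairs of every
`U̿^{(j)}W`, `j < k`, within `δ` of `1`; `μ` with `‖μ‖ ≤ a` and linear oscillations `≤ ω·2^{j+1}/2^k`; a direction `ν` with `‖ν‖ ≤ n` and
linear oscillations `≤ n·2^{j+1}/2^k`; a scale `r` with `n ≤ r/4` and `160(a + r + δ + 5(ω + r)) ≤ 1/4`.  Then the nonlinear part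
`C(m) := log κf(m)_k(y) − (Q′_k m)(y)` satisfies `‖C(μ + ν) − C(μ)‖ ≤ 2·M·n/r`, `M := 640(a + r + δ + 5(ω + r))(ω + r)` — the value bound
of ✓`norm_mlog_effGauge_top_sub_siteAvgIter_le` on the complex ball `|τ| < r/n` around `μ` along `ν`, turned into a Lipschitz bound by
§1; constant independent of `k` (the `hC125` row of ✓`B8SectEKLevelFamily` with `α₃ ↦ α₃ + δ̄`, LEAD-H 11:30:32Z).
[cite: Balaban1985RegularSpaces, Sect. E (1.122)-(1.125) pp.96-97] -/
theorem norm_Cnl_sub_Cnl_le [Nonempty (Idx P)] (W : GaugeField P 0 𝔸ˣ) (κf : (Site P 0 → 𝔸) → (i : ℕ) → GaugeTransf P i 𝔸ˣ)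
    (hs : ∀ (m : Site P 0 → 𝔸) (i : ℕ) (y : Site P (i + 1)),
      κf m (i + 1) y = (vframeU (gaugeActT (κf m i) (dbarIterU i W)) y)⁻¹ * κf m i (emb y) * vframeU (dbarIterU i W) y)
    (h0 : ∀ (m : Site P 0 → 𝔸) (x : Site P 0), ((κf m 0 x : 𝔸ˣ) : 𝔸) = exp (m x))
    {a δ ω n r : ℝ} (hδ : 0 ≤ δ) (hω : 0 ≤ ω) (hn : 0 ≤ n) (hr0 : 0 < r) (hnr : n ≤ r / 4) (k : ℕ)
    (hH : ∀ j < k, ∀ (y : Site P (j + 1)) (idx : Idx P),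
      ‖((holT (dbarIterU j W) (emb y) (stairWord idx.2.1 (off idx.1)) : 𝔸ˣ) : 𝔸) - 1‖ ≤ δ)
    (μ ν : Site P 0 → 𝔸) (ha : ∀ x, ‖μ x‖ ≤ a) (hνn : ∀ x, ‖ν x‖ ≤ n)
    (hosc : ∀ j < k, ∀ (y : Site P (j + 1)) (idx : Idx P),
      ‖siteAvgIter j μ (walkEnd (emb y) (stairWord idx.2.1 (off idx.1))) - siteAvgIter j μ (emb y)‖ ≤ ω * 2 ^ (j + 1) / 2 ^ k)
    (hνosc : ∀ j < k, ∀ (y : Site P (j + 1)) (idx : Idx P),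
      ‖siteAvgIter j ν (walkEnd (emb y) (stairWord idx.2.1 (off idx.1))) - siteAvgIter j ν (emb y)‖ ≤ n * 2 ^ (j + 1) / 2 ^ k)
    (hr : 160 * (a + r + δ + 5 * (ω + r)) ≤ 1 / 4) (y : Site P k) :
    ‖(mlog ((κf (μ + ν) k y : 𝔸ˣ) : 𝔸) - siteAvgIter k (μ + ν) y) - (mlog ((κf μ k y : 𝔸ˣ) : 𝔸) - siteAvgIter k μ y)‖ ≤
      2 * (640 * (a + r + δ + 5 * (ω + r)) * (ω + r)) * n / r := by
  have ha0 : 0 ≤ a := (norm_nonneg _).trans (ha (emb (Classical.arbitrary (Site P 1))))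
  set M : ℝ := 640 * (a + r + δ + 5 * (ω + r)) * (ω + r) with hMdef
  have hM0 : 0 ≤ M := by positivity
  -- the trivial case `n = 0`
  rcases hn.eq_or_lt with hn0 | hnpos
  · have hν : ν = 0 := by funext x; have := hνn x; rw [← hn0] at this; exact norm_le_zero_iff.mp this
    rw [hν, add_zero, sub_self, norm_zero, ← hn0]; positivity
  -- the function along the line and its value bound on the ball of radius `R = r/n`
  set R : ℝ := r / n with hR
  have hRpos : 0 < R := by positivity
  set g : ℂ → 𝔸 := fun τ => mlog ((κf (μ + τ • ν) k y : 𝔸ˣ) : 𝔸) - siteAvgIter k (μ + τ • ν) y with hg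
  have hline : ∀ τ : ℂ, ‖τ‖ < R →
      (∀ x, ‖(μ + τ • ν) x‖ ≤ a + r) ∧
      (∀ j < k, ∀ (y : Site P (j + 1)) (idx : Idx P),
        ‖siteAvgIter j (μ + τ • ν) (walkEnd (emb y) (stairWord idx.2.1 (off idx.1))) - siteAvgIter j (μ + τ • ν) (emb y)‖ ≤
          (ω + r) * 2 ^ (j + 1) / 2 ^ k) := by
    intro τ hτ
    have hτn : ‖τ‖ * n ≤ r := by
      rw [hR, lt_div_iff₀ hnpos] at hτ; exact hτ.le
    refine ⟨fun x => ?_, fun j hj y' idx => ?_⟩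
    · calc ‖(μ + τ • ν) x‖ = ‖μ x + τ • ν x‖ := rfl
        _ ≤ ‖μ x‖ + ‖τ‖ * ‖ν x‖ := (norm_add_le _ _).trans (by rw [norm_smul])
        _ ≤ a + ‖τ‖ * n := add_le_add (ha x) (mul_le_mul_of_nonneg_left (hνn x) (norm_nonneg _))
        _ ≤ a + r := by linarith
    · rw [siteAvgIter_add_smul μ ν τ j]
      simp only [Pi.add_apply, Pi.smul_apply]
      have e1 := hosc j hj y' idx
      have e2 := hνosc j hj y' idx
      have h2k : (0 : ℝ) ≤ 2 ^ (j + 1) / 2 ^ k := by positivity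
      calc _ = ‖(siteAvgIter j μ (walkEnd (emb y') (stairWord idx.2.1 (off idx.1))) - siteAvgIter j μ (emb y')) +
            τ • (siteAvgIter j ν (walkEnd (emb y') (stairWord idx.2.1 (off idx.1))) - siteAvgIter j ν (emb y'))‖ := by
              congr 1; rw [smul_sub]; abel
        _ ≤ ω * 2 ^ (j + 1) / 2 ^ k + ‖τ‖ * (n * 2 ^ (j + 1) / 2 ^ k) :=
            (norm_add_le _ _).trans (add_le_add e1 (by rw [norm_smul]; exact mul_le_mul_of_nonneg_left e2 (norm_nonneg _)))
        _ ≤ (ω + r) * 2 ^ (j + 1) / 2 ^ k := by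
            have : ‖τ‖ * (n * 2 ^ (j + 1) / 2 ^ k) = (‖τ‖ * n) * (2 ^ (j + 1) / 2 ^ k) := by ring
            rw [this, mul_div_assoc, mul_div_assoc, add_mul]
            linarith [mul_le_mul_of_nonneg_right hτn h2k]
  have hωr : 0 ≤ ω + r := by positivity
  have hrk : 160 * ((a + r) + δ + 5 * (ω + r)) ≤ 1 / 4 := by linarith
  -- the size row on the ball: every level is `exp ∘ log`, and the value bound `‖g τ‖ ≤ M`
  have htower : ∀ τ : ℂ, ‖τ‖ < R → ∀ j ≤ k, ∀ x : Site P j,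
      exp (mlog ((κf (μ + τ • ν) j x : 𝔸ˣ) : 𝔸)) = ((κf (μ + τ • ν) j x : 𝔸ˣ) : 𝔸) ∧
        ‖mlog ((κf (μ + τ • ν) j x : 𝔸ˣ) : 𝔸) - siteAvgIter j (μ + τ • ν) x‖ ≤
          4 * (160 * ((a + r) + δ + 5 * (ω + r))) * (ω + r) * (2 ^ j / 2 ^ k) := fun τ hτ =>
    exp_mlog_and_norm_mlog_effGauge_sub_siteAvgIter_le W (κf (μ + τ • ν)) (hs _) (μ + τ • ν) (h0 _) hδ hωr (hline τ hτ).1 k hH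
      (hline τ hτ).2 hrk
  have hbound : ∀ τ ∈ ball (0 : ℂ) R, ‖g τ‖ ≤ M := by
    intro τ hτ
    rw [mem_ball, dist_zero_right] at hτ
    have h := (htower τ hτ k le_rfl y).2
    have h2k : (2 : ℝ) ^ k / 2 ^ k = 1 := div_self (by positivity)
    rw [h2k, mul_one] at h
    exact h.trans (le_of_eq (by rw [hMdef]; ring))
  -- differentiability of `g` on the ball: analyticity of the tower (§3) and of the linear part
  have hdiff : DifferentiableOn ℂ g (ball (0 : ℂ) R) := by
    intro τ₀ hτ₀
    rw [mem_ball, dist_zero_right] at hτ₀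
    have hsize : ∀ j ≤ k, ∀ x : Site P j, ‖mlog ((κf (μ + τ₀ • ν) j x : 𝔸ˣ) : 𝔸)‖ ≤ (a + r) + (ω + r) := by
      intro j hj x
      have h := (htower τ₀ hτ₀ j hj x).2
      have hQ : ‖siteAvgIter j (μ + τ₀ • ν) x‖ ≤ a + r :=
        norm_siteAvgIter_le _ (by positivity) (hline τ₀ hτ₀).1 j x
      have hjk : (2 : ℝ) ^ j / 2 ^ k ≤ 1 := by
        rw [div_le_one (by positivity)]; exact pow_le_pow_right₀ (by norm_num) hj
      have h4 : 4 * (160 * ((a + r) + δ + 5 * (ω + r))) * (ω + r) * (2 ^ j / 2 ^ k) ≤ ω + r := by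
        have : 4 * (160 * ((a + r) + δ + 5 * (ω + r))) * (ω + r) * (2 ^ j / 2 ^ k) ≤
            4 * (160 * ((a + r) + δ + 5 * (ω + r))) * (ω + r) * 1 :=
          mul_le_mul_of_nonneg_left hjk (by positivity)
        nlinarith
      calc _ = ‖(mlog ((κf (μ + τ₀ • ν) j x : 𝔸ˣ) : 𝔸) - siteAvgIter j (μ + τ₀ • ν) x) + siteAvgIter j (μ + τ₀ • ν) x‖ := by
            rw [sub_add_cancel]
        _ ≤ (ω + r) + (a + r) := (norm_add_le _ _).trans (add_le_add (h.trans h4) hQ)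
        _ = (a + r) + (ω + r) := add_comm _ _
    have hdisc : ∀ i < k, ∀ (y' : Site P (i + 1)) (idx : Idx P),
        ‖((holT (dbarIterU i W) (emb y') (stairWord idx.2.1 (off idx.1)) : 𝔸ˣ) : 𝔸) *
            (((κf (μ + τ₀ • ν) i (walkEnd (emb y') (stairWord idx.2.1 (off idx.1))))⁻¹ * κf (μ + τ₀ • ν) i (emb y') : 𝔸ˣ) : 𝔸) -
              1‖ < 1 := by
      intro i hi y' idx
      exact norm_stairRel_sub_one_lt_one _ (κf (μ + τ₀ • ν) i) (fun x => mlog ((κf (μ + τ₀ • ν) i x : 𝔸ˣ) : 𝔸)) _ _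
        (fun x => ((htower τ₀ hτ₀ i hi.le x).1).symm) (hH i hi y' idx) (hsize i hi.le _) (hsize i hi.le _) (by linarith) (by linarith)
    have hval := (analyticAt_effGauge_line W κf hs h0 μ ν τ₀ k hdisc k le_rfl y).1
    have htop : ‖((κf (μ + τ₀ • ν) k y : 𝔸ˣ) : 𝔸) - 1‖ < 1 := by
      rw [← (htower τ₀ hτ₀ k le_rfl y).1]
      have h4 : ‖mlog ((κf (μ + τ₀ • ν) k y : 𝔸ˣ) : 𝔸)‖ + ‖(0 : 𝔸)‖ ≤ 1 / 4 := by
        rw [norm_zero, add_zero]; linarith [hsize k le_rfl y]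
      simpa only [exp_zero, mul_one] using norm_expMul_sub_one_lt_one h4
    have hlog : AnalyticAt ℂ (fun τ : ℂ => mlog ((κf (μ + τ • ν) k y : 𝔸ˣ) : 𝔸)) τ₀ :=
      (MatrixLog.analyticAt_mlog htop).fun_comp_of_eq hval rfl
    have hlinpart : AnalyticAt ℂ (fun τ : ℂ => siteAvgIter k (μ + τ • ν) y) τ₀ := by
      have : (fun τ : ℂ => siteAvgIter k (μ + τ • ν) y) = fun τ => siteAvgIter k μ y + τ • siteAvgIter k ν y := by
        funext τ; rw [siteAvgIter_add_smul μ ν τ k]; rfl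
      rw [this]
      exact analyticAt_const.add (analyticAt_id.smul analyticAt_const)
    exact (hlog.sub hlinpart).differentiableAt.differentiableWithinAt
  -- Cauchy ⇒ Lipschitz between `τ = 1` and `τ = 0`
  have hR4 : 4 ≤ R := by rw [hR, le_div_iff₀ hnpos]; linarith
  have h1 : (1 : ℂ) ∈ ball (0 : ℂ) (R / 2) := by rw [mem_ball, dist_zero_right, norm_one]; linarith
  have h0' : (0 : ℂ) ∈ ball (0 : ℂ) (R / 2) := mem_ball_self (by linarith)
  have hlip := norm_sub_le_of_bound_on_ball hRpos hdiff hbound h1 h0'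
  have hg1 : g 1 = mlog ((κf (μ + ν) k y : 𝔸ˣ) : 𝔸) - siteAvgIter k (μ + ν) y := by rw [hg]; simp only [one_smul]
  have hg0 : g 0 = mlog ((κf μ k y : 𝔸ˣ) : 𝔸) - siteAvgIter k μ y := by rw [hg]; simp only [zero_smul, add_zero]
  rw [← hg1, ← hg0]
  calc ‖g 1 - g 0‖ ≤ 2 * M / R * ‖(1 : ℂ) - 0‖ := hlip
    _ = 2 * M * n / r := by rw [sub_zero, norm_one, mul_one, hR]; field_simp

end Lipschitz

/-! ## §5 The tower as a function of the bottom gauge (the `κf` of §3–§4 exists) -/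

section TowerFun

open B7Prop1Explicit (expUnit val_expUnit)
open Summit.QuantumFields.YangMills.Theorems.P1FlatCoreFrameLinTower (exists_effGauge)

/-- **THE HYPOTHESIS-FUNCTION `κf` EXISTS**: there is a tower-valued function of the bottom gauge `m ↦ κf m` obeying the recursion of
✓`exists_effGauge` for every `m`, starting at `κf m 0 = exp ∘ m`, and identifying the double-bar tower of the gauge copy
`(e^{m})·W` with the `κf m`-copy of the tower of `W` at every level (✓`dbarIterU_gaugeActT_eq_effGauge`) — so the `κf` binders of
✓`analyticAt_effGauge_line` / ✓`norm_Cnl_sub_Cnl_le` are dischargeable by ONE choice. [cite: Balaban1985Averaging, (97)-(100) p.32] -/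
theorem exists_effGaugeFun (W : GaugeField P 0 𝔸ˣ) :
    ∃ κf : (Site P 0 → 𝔸) → (i : ℕ) → GaugeTransf P i 𝔸ˣ,
      (∀ (m : Site P 0 → 𝔸) (i : ℕ) (y : Site P (i + 1)),
        κf m (i + 1) y = (vframeU (gaugeActT (κf m i) (dbarIterU i W)) y)⁻¹ * κf m i (emb y) * vframeU (dbarIterU i W) y) ∧
      (∀ (m : Site P 0 → 𝔸) (x : Site P 0), ((κf m 0 x : 𝔸ˣ) : 𝔸) = exp (m x)) ∧
      ∀ (m : Site P 0 → 𝔸) (i : ℕ), dbarIterU i (gaugeActT (fun x => expUnit (m x)) W) = gaugeActT (κf m i) (dbarIterU i W) := by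
  refine ⟨fun m => Classical.choose (exists_effGauge W fun x => expUnit (m x)), fun m => ?_, fun m x => ?_, fun m => ?_⟩
  · exact (Classical.choose_spec (exists_effGauge W fun x => expUnit (m x))).2.1
  · show (((Classical.choose (exists_effGauge W fun x => expUnit (m x))) 0 x : 𝔸ˣ) : 𝔸) = exp (m x)
    rw [(Classical.choose_spec (exists_effGauge W fun x => expUnit (m x))).1, val_expUnit]
  · exact (Classical.choose_spec (exists_effGauge W fun x => expUnit (m x))).2.2

end TowerFun

end Summit.QuantumFields.YangMills.Theorems.P1FlatCoreFrameLinLipschitz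

end
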